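import Summits.Ventures.PercRepro.PuncturedLYMMatchingMain

/-!
# PercRepro — (SP) FOR ONE CODE WORD, PART 1: THE RADIAL WEIGHTS OF ANY SEQUENCE WITH THE KIRCHHOFF RECURRENCE
GIVE (SP) (p10, gen 30; continues PuncturedLYM / PuncturedLYMMatchingMain)

For `D = {B}` (`#B = j`) the level `P` consists of the `j`-sets `X ≠ B`; write `a(X) = #(X ∩ B) ≤ j − 1`.  Given any
sequence `d : ℕ → ℚ` define the RADIAL WEIGHTS of the pair `(X, X ∪ y)`: `win a = (1 + (n − 2j + a)·d a)/(n − j)` when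
`y ∈ B` and `wout a = (1 − (j − a)·d a)/(n − j)` when `y ∉ B` (`a = a(X)`).
* `sum_sups_sW` — the ROW SUMS are `1` for EVERY `d` (`j − a` completing points lie in `B`, `n − 2j + a` outside `B`);
* `sum_subsP_sW_lt`, `sum_subsP_sW_top` — the COLUMN SUM at a `(j+1)`-set `Y` with `m = #(Y ∩ B)` is
  `m·win(m−1) + (j+1−m)·wout m` for `m < j` (the `P`-subsets are the `Y ∖ z`) and `j·win(j−1)` for `m = j` (the subset
  `B` is excluded);
The reduction theorem `puncturedNMP_single_of_seq` ((SP) for `{B}` from any sequence `d` with the Kirchhoff recurrence)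
is PuncturedLYMSingleMain; the explicit flux sequence `d m = τ·C_{≤m}/N_m` (paper §3b) is a successor item.
Nothing here asserts (SP).
-/

namespace PercRepro.PuncturedLYM

open Finset

variable {α : Type} [Fintype α] [DecidableEq α]

/-! ### The single-word code -/

omit [Fintype α] in
/-- `{B}` is a code of `j`-sets. -/
theorem isCode_singleton {j : ℕ} {B : Finset α} (hB : B.card = j) : IsCode j ({B} : Finset (Finset α)) := by
  refine ⟨fun B' hB' => ?_, fun B' hB' B'' hB'' hne => ?_⟩
  · rw [mem_singleton] at hB'
    rw [hB', hB]
  · rw [mem_singleton] at hB' hB''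
    exact absurd (hB'.trans hB''.symm) hne

/-- Membership in `P` for the single-word code. -/
theorem mem_punctured_singleton {j : ℕ} {B X : Finset α} :
    X ∈ punctured j ({B} : Finset (Finset α)) ↔ X.card = j ∧ X ≠ B := by
  rw [mem_punctured, mem_singleton]

omit [Fintype α] [DecidableEq α] in
/-- A `(j+1)`-set is touched by `{B}` iff it contains `B`. -/
theorem touched_singleton_iff {B Y : Finset α} : Touched ({B} : Finset (Finset α)) Y ↔ B ⊆ Y := by
  constructor
  · rintro ⟨B', hB', h⟩
    rw [mem_singleton] at hB'
    exact hB' ▸ h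
  · intro h
    exact ⟨B, mem_singleton_self B, h⟩

/-- `a(X) = #(X ∩ B)`. -/
def aOf (B X : Finset α) : ℕ := (X ∩ B).card

omit [Fintype α] in
/-- The completing points of a `j`-set `X ≠ B` inside `B` number `j − a(X)`. -/
theorem card_sdiff_B {j : ℕ} {B X : Finset α} (hB : B.card = j) :
    (B \ X).card + aOf B X = j := by
  unfold aOf
  rw [inter_comm, card_sdiff_add_card_inter, hB]

omit [Fintype α] in
/-- `#(X ∪ B) = #X + #B − a(X)`. -/
theorem card_union_B (B X : Finset α) : (X ∪ B).card + aOf B X = X.card + B.card :=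
  card_union_add_card_inter X B

omit [Fintype α] in
/-- `a(X) ≤ j − 1` for `X ∈ P`: a `j`-set other than `B` does not contain `B`. -/
theorem aOf_lt {j : ℕ} {B X : Finset α} (hB : B.card = j) (hX : X.card = j) (hne : X ≠ B) : aOf B X < j := by
  unfold aOf
  by_contra h
  have h1 : (X ∩ B).card = j := le_antisymm (hX ▸ card_le_card inter_subset_left) (not_lt.1 h)
  have h2 : X ∩ B = X := eq_of_subset_of_card_le inter_subset_left (by omega)
  have h3 : X ⊆ B := h2 ▸ inter_subset_right
  exact hne (eq_of_subset_of_card_le h3 (by omega))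

/-! ### The radial weights -/

/-- The radial weight for a completing point inside `B`. -/
def win (α : Type) [Fintype α] (j : ℕ) (d : ℕ → ℚ) (a : ℕ) : ℚ :=
  (1 + ((Fintype.card α : ℚ) - 2 * j + a) * d a) / ((Fintype.card α : ℚ) - j)

/-- The radial weight for a completing point outside `B`. -/
def wout (α : Type) [Fintype α] (j : ℕ) (d : ℕ → ℚ) (a : ℕ) : ℚ :=
  (1 - ((j : ℚ) - a) * d a) / ((Fintype.card α : ℚ) - j)

/-- The weight of the completion `X ↦ insert y X`. -/
def sW (α : Type) [Fintype α] [DecidableEq α] (j : ℕ) (d : ℕ → ℚ) (B X : Finset α) (y : α) : ℚ :=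
  if y ∈ B then win α j d (aOf B X) else wout α j d (aOf B X)

/-- The radial weights on a pair `(X, Y)`: `sW` at the point of `Y ∖ X`. -/
def sWp (α : Type) [Fintype α] [DecidableEq α] (j : ℕ) (d : ℕ → ℚ) (B X Y : Finset α) : ℚ :=
  ∑ y ∈ Y \ X, sW α j d B X y

/-- `sWp X (insert y X) = sW X y` for `y ∉ X`. -/
theorem sWp_insert (j : ℕ) (d : ℕ → ℚ) (B X : Finset α) {y : α} (hy : y ∉ X) :
    sWp α j d B X (insert y X) = sW α j d B X y := by
  unfold sWp
  have h : insert y X \ X = {y} := by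
    ext z
    simp only [mem_sdiff, mem_insert, mem_singleton]
    constructor
    · rintro ⟨h1, h2⟩
      exact h1.resolve_right h2
    · rintro rfl
      exact ⟨Or.inl rfl, hy⟩
  rw [h, sum_singleton]

/-! ### Row sums -/

/-- **The row sums are `1`** for every sequence `d` (a `j`-set `X ≠ B`, `j < n`). -/
theorem sum_sups_sW {j : ℕ} (d : ℕ → ℚ) {B X : Finset α} (hB : B.card = j) (hX : X.card = j)
    (hjn : j < Fintype.card α) : ∑ Y ∈ sups j X, sWp α j d B X Y = 1 := by
  rw [sum_sups hX]
  have h1 : ∀ y ∈ univ \ X, sWp α j d B X (insert y X) = sW α j d B X y :=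
    fun y hy => sWp_insert j d B X (mem_sdiff.1 hy).2
  rw [sum_congr rfl h1]
  unfold sW
  rw [sum_ite, sum_const, sum_const, nsmul_eq_mul, nsmul_eq_mul]
  have hBX : (univ \ X).filter (fun y => y ∈ B) = B \ X := by
    ext y
    simp only [mem_filter, mem_sdiff, mem_univ, true_and]
    tauto
  have hBX' : (univ \ X).filter (fun y => ¬ y ∈ B) = univ \ (X ∪ B) := by
    ext y
    simp only [mem_filter, mem_sdiff, mem_univ, true_and, mem_union, not_or]
  rw [hBX, hBX', card_univ_sdiff]
  have hc1 := card_sdiff_B (X := X) hB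
  have hc2 := card_union_B B X
  rw [hX, hB] at hc2
  have hXB : (X ∪ B).card ≤ Fintype.card α := card_le_univ _
  have ha : aOf B X ≤ j := by omega
  have e1 : ((B \ X).card : ℚ) = j - aOf B X := by
    have : (B \ X).card = j - aOf B X := by omega
    rw [this, Nat.cast_sub ha]
  have e2 : ((Fintype.card α - (X ∪ B).card : ℕ) : ℚ) = (Fintype.card α : ℚ) - 2 * j + aOf B X := by
    rw [Nat.cast_sub hXB]
    have : ((X ∪ B).card : ℚ) = 2 * j - aOf B X := by
      have : (X ∪ B).card = 2 * j - aOf B X := by omega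
      rw [this, Nat.cast_sub (by omega)]
      push_cast
      ring
    rw [this]
    ring
  rw [e1, e2]
  unfold win wout
  have hnj : ((Fintype.card α : ℚ) - j) ≠ 0 := by
    have : (j : ℚ) < Fintype.card α := by exact_mod_cast hjn
    linarith
  field_simp
  ring

/-! ### Column sums -/

/-- The `P`-subsets of a `(j+1)`-set `Y` with `#(Y ∩ B) < j` are all its `j`-subsets `Y.erase z`. -/
theorem subsP_singleton_eq_image_erase {j : ℕ} {B Y : Finset α} (hB : B.card = j) (hY : Y.card = j + 1)
    (hm : (Y ∩ B).card < j) : subsP j ({B} : Finset (Finset α)) Y = Y.image (fun z => Y.erase z) := by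
  ext X
  simp only [mem_subsP, mem_image, mem_singleton]
  constructor
  · rintro ⟨⟨hXc, -⟩, hXY⟩
    have h1 : (Y \ X).card = 1 := by
      rw [card_sdiff_of_subset hXY]
      omega
    obtain ⟨z, hz⟩ := card_eq_one.1 h1
    have hzY : z ∈ Y \ X := hz ▸ mem_singleton_self z
    rw [mem_sdiff] at hzY
    refine ⟨z, hzY.1, ?_⟩
    symm
    apply eq_of_subset_of_card_le
    · intro w hw
      rw [mem_erase]
      refine ⟨?_, hXY hw⟩
      rintro rfl
      exact hzY.2 hw
    · rw [card_erase_of_mem hzY.1, hY, hXc, Nat.add_sub_cancel]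
  · rintro ⟨z, hzY, rfl⟩
    refine ⟨⟨by rw [card_erase_of_mem hzY, hY, Nat.add_sub_cancel], ?_⟩, erase_subset z Y⟩
    intro hBz
    -- `B = Y.erase z ⊆ Y` would give `#(Y ∩ B) = j`
    have : B ⊆ Y := hBz ▸ erase_subset z Y
    have h2 : Y ∩ B = B := inter_eq_right.2 this
    rw [h2, hB] at hm
    exact lt_irrefl _ hm

omit [Fintype α] in
/-- `a(Y.erase z) = #(Y ∩ B) − [z ∈ B]` for `z ∈ Y`. -/
theorem aOf_erase (B : Finset α) {Y : Finset α} {z : α} (hz : z ∈ Y) :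
    aOf B (Y.erase z) + (if z ∈ B then 1 else 0) = (Y ∩ B).card := by
  unfold aOf
  rw [erase_inter]
  split_ifs with hzB
  · rw [card_erase_of_mem (mem_inter.2 ⟨hz, hzB⟩)]
    have : 0 < (Y ∩ B).card := card_pos.2 ⟨z, mem_inter.2 ⟨hz, hzB⟩⟩
    omega
  · rw [erase_eq_of_notMem (fun h => hzB (mem_inter.1 h).2), add_zero]

/-- **The column sum at a `(j+1)`-set with `m = #(Y ∩ B) < j`** is `m·win(m−1) + (j+1−m)·wout m`. -/
theorem sum_subsP_sW_lt {j : ℕ} (d : ℕ → ℚ) {B Y : Finset α} (hB : B.card = j) (hY : Y.card = j + 1)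
    (hm : (Y ∩ B).card < j) :
    ∑ X ∈ subsP j ({B} : Finset (Finset α)) Y, sWp α j d B X Y =
      ((Y ∩ B).card : ℚ) * win α j d ((Y ∩ B).card - 1) + ((j : ℚ) + 1 - (Y ∩ B).card) * wout α j d (Y ∩ B).card := by
  rw [subsP_singleton_eq_image_erase hB hY hm, sum_image (erase_injOn Y)]
  have h1 : ∀ z ∈ Y, sWp α j d B (Y.erase z) Y =
      if z ∈ B then win α j d ((Y ∩ B).card - 1) else wout α j d (Y ∩ B).card := by
    intro z hz
    unfold sWp
    rw [sdiff_erase_eq_singleton hz, sum_singleton]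
    unfold sW
    have hk := aOf_erase B hz
    split_ifs with hzB
    · rw [if_pos hzB] at hk
      have : aOf B (Y.erase z) = (Y ∩ B).card - 1 := by omega
      rw [this]
    · rw [if_neg hzB, add_zero] at hk
      rw [hk]
  rw [sum_congr rfl h1, sum_ite, sum_const, sum_const, nsmul_eq_mul, nsmul_eq_mul]
  have hk1 : (Y.filter (fun z => z ∈ B)).card = (Y ∩ B).card := by rw [filter_mem_eq_inter]
  have hk2 : (Y.filter (fun z => ¬ z ∈ B)).card = j + 1 - (Y ∩ B).card := by
    have := card_filter_add_card_filter_not (fun z => z ∈ B) (s := Y)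
    rw [hY] at this
    omega
  rw [hk1, hk2, Nat.cast_sub (by omega)]
  push_cast
  ring

/-- **The column sum at a `(j+1)`-set containing `B`** is `j·win(j−1)`. -/
theorem sum_subsP_sW_top {j : ℕ} (d : ℕ → ℚ) {B Y : Finset α} (hB : B.card = j) (hY : Y.card = j + 1)
    (hBY : B ⊆ Y) :
    ∑ X ∈ subsP j ({B} : Finset (Finset α)) Y, sWp α j d B X Y = (j : ℚ) * win α j d (j - 1) := by
  -- the `P`-subsets are the `Y.erase z`, `z ∈ B`
  have hsub : subsP j ({B} : Finset (Finset α)) Y = B.image (fun z => Y.erase z) := by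
    ext X
    simp only [mem_subsP, mem_image, mem_singleton]
    constructor
    · rintro ⟨⟨hXc, hXB⟩, hXY⟩
      have h1 : (Y \ X).card = 1 := by
        rw [card_sdiff_of_subset hXY]
        omega
      obtain ⟨z, hz⟩ := card_eq_one.1 h1
      have hzY : z ∈ Y \ X := hz ▸ mem_singleton_self z
      rw [mem_sdiff] at hzY
      have hXe : X = Y.erase z := by
        apply eq_of_subset_of_card_le
        · intro w hw
          rw [mem_erase]
          refine ⟨?_, hXY hw⟩
          rintro rfl
          exact hzY.2 hw
        · rw [card_erase_of_mem hzY.1, hY, hXc, Nat.add_sub_cancel]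
      refine ⟨z, ?_, hXe.symm⟩
      -- if `z ∉ B` then `B ⊆ Y.erase z = X`, so `X = B`
      by_contra hzB
      have hBX : B ⊆ X := by
        rw [hXe]
        intro w hw
        rw [mem_erase]
        exact ⟨fun h => hzB (h ▸ hw), hBY hw⟩
      exact hXB (eq_of_subset_of_card_le hBX (by omega)).symm
    · rintro ⟨z, hzB, rfl⟩
      refine ⟨⟨by rw [card_erase_of_mem (hBY hzB), hY, Nat.add_sub_cancel], ?_⟩, erase_subset z Y⟩
      intro h
      have : z ∈ Y.erase z := h ▸ hzB
      exact (mem_erase.1 this).1 rfl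
  rw [hsub, sum_image (fun z hz z' hz' h => erase_injOn Y (hBY hz) (hBY hz') h)]
  have h1 : ∀ z ∈ B, sWp α j d B (Y.erase z) Y = win α j d (j - 1) := by
    intro z hz
    unfold sWp
    rw [sdiff_erase_eq_singleton (hBY hz), sum_singleton]
    unfold sW
    rw [if_pos hz]
    have hk := aOf_erase B (hBY hz)
    rw [if_pos hz, inter_eq_right.2 hBY, hB] at hk
    have : aOf B (Y.erase z) = j - 1 := by omega
    rw [this]
  rw [sum_congr rfl h1, sum_const, nsmul_eq_mul, hB]

end PercRepro.PuncturedLYM
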